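import Mathlib
import Literature.Computability.AlgebraicComplexity.JointCircuits
import Literature.Computability.AlgebraicComplexity.FastFourierTransform
import HarnessLib

/-!
# The FFT and fast convolution as circuits: the cost layer of `FastFourierTransform.lean`

Topic `Computability/AlgebraicComplexity`, namespace `Literature.Computability.AlgebraicComplexity`.
Everything PROVED; one definition (`lconv`, the Cauchy product of sequences), no named facts.

`FastFourierTransform.lean` proves the ALGEBRA of the radix-2 FFT and of fast cyclic convolution
over an arbitrary commutative ring (`dft`, `fft_eq_dft`, `dft_dft`, `dft_cconv`); operation counts
were deliberately left out there.  This file supplies them in the tree's circuit model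
(`complexity`, Bürgisser's fan-in-two circuits with weighted sum gates; multi-output bookkeeping by
`JointlyComputed`, `JointCircuits.lean`), for sequences of CIRCUIT NODES — polynomials in
`k[X_τ]` — and a scalar root of unity `ω = C ζ`, `ζ^{2^{κ-1}} = −1` (von zur Gathen–Gerhard,
*Modern Computer Algebra*, §8.2, Thm 8.15 and Thm 8.18, cost parts):

* `jointlyComputed_dft` — the DFT of length `2^κ` of `2^κ` nodes costs `κ · 2^κ` gates (each
  butterfly output `a_l + a_{h+l}`, `(a_l − a_{h+l}) ζ^l` is ONE weighted sum gate);
* `jointlyComputed_cconv` — cyclic convolution of length `2^κ` (`κ ≥ 1`) costs `(3κ + 2) · 2^κ`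
  gates (three FFTs, `2^κ` pointwise products, `2^κ` scalings of the reversed third transform by
  `(2^κ)⁻¹`);
* `lconv`, `cconv_eq_lconv` (no wrap-around for short supports), `jointlyComputed_lconv` — all
  coefficients of the product of two node polynomials with `la + lb ≤ 2^κ + 1` coefficients cost
  `(3κ + 2) · 2^κ` gates.

## References

* J. von zur Gathen, J. Gerhard, *Modern Computer Algebra*, CUP (3rd ed. 2013), §8.2,
  Algorithm 8.14 / Thm 8.15 (FFT, `n log n`), Algorithm 8.16 / Thm 8.18 (fast convolution).
  [GathenGerhard2013]
* [Burgisser2000] P. Bürgisser, *Completeness and Reduction in Algebraic Complexity Theory*,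
  Springer 2000, Def. 2.1 (the circuit model).
-/

noncomputable section

open MvPolynomial

namespace Literature.Computability.AlgebraicComplexity

/-! ### The cost of the DFT: `κ · 2^κ` gates for length `2^κ` -/

section FFTCost

universe uu vv ww

variable {k : Type uu} [CommRing k] {τ : Type vv}

open _root_.Finset

/-- **The FFT as a circuit: a DFT of length `2^κ` of circuit nodes costs `κ · 2^κ` weighted-addition
gates.** If the sequence `a_0, …, a_{2^κ-1}` is read off a jointly computed family within `s`
gates, then so is the family extended by `DFT_ω(a)_j` (`j < 2^κ`, `ω = C ζ` with
`ζ^{2^{κ-1}} = −1`) within `s + κ · 2^κ` gates: one butterfly pass (`2^κ` gates: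
`a_l + a_{h+l}` and `(a_l − a_{h+l}) ζ^l`), then two half-length transforms with `ζ²`
(GG Algorithm 8.14 / Thm 8.15, cost part: `n log n` additions and scalings, the scalings being
free in Bürgisser's weighted sum gates). [cite: GathenGerhard2013, §8.2 Thm 8.15] -/
theorem jointlyComputed_dft :
    ∀ (κ : ℕ) {ι : Type ww} (v : ι → MvPolynomial τ k) (s : ℕ) (ζ : k)
      (a : ℕ → MvPolynomial τ k) (e : Fin (2 ^ κ) → ι),
      JointlyComputed v s → (∀ i : Fin (2 ^ κ), v (e i) = a i) →
      (κ ≠ 0 → ζ ^ 2 ^ (κ - 1) = -1) →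
      JointlyComputed (Sum.elim v (fun j : Fin (2 ^ κ) => dft (2 ^ κ) (C ζ) a j))
        (s + κ * 2 ^ κ)
  | 0, ι, v, s, ζ, a, e, hv, he, _ => by
    rw [Nat.zero_mul, Nat.add_zero]
    refine hv.of_mem _ ?_
    rintro (i | j)
    · exact Or.inl ⟨i, rfl⟩
    · refine Or.inl ⟨e 0, ?_⟩
      have hj : j = 0 := Fin.ext (by have := j.isLt; simp at this; omega)
      subst hj
      simp [dft, he]
  | κ + 1, ι, v, s, ζ, a, e, hv, he, hζ => by
    have hζk : ζ ^ 2 ^ κ = -1 := hζ (Nat.succ_ne_zero κ)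
    have hζ2 : κ ≠ 0 → (ζ * ζ) ^ 2 ^ (κ - 1) = -1 := by
      intro hk
      rw [mul_pow, ← pow_add, ← two_mul, ← pow_succ', Nat.sub_add_cancel (Nat.one_le_iff_ne_zero.2 hk)]
      exact hζk
    have hlen : 2 ^ (κ + 1) = 2 ^ κ + 2 ^ κ := by rw [pow_succ, mul_two]
    have hω : (C ζ : MvPolynomial τ k) ^ 2 ^ κ = -1 := by rw [← C_pow, hζk, C_neg, C_1]
    -- the two half-length sequences of GG Algorithm 8.14
    set b : ℕ → MvPolynomial τ k := fun l => a l + a (2 ^ κ + l) with hb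
    set c : ℕ → MvPolynomial τ k := fun l => (a l - a (2 ^ κ + l)) * (C ζ) ^ l with hc
    -- indices of `a l` and `a (2^κ + l)` for `l < 2^κ`
    let lo : Fin (2 ^ κ) → Fin (2 ^ (κ + 1)) := fun l => ⟨l, by omega⟩
    let hi : Fin (2 ^ κ) → Fin (2 ^ (κ + 1)) := fun l => ⟨2 ^ κ + l, by omega⟩
    -- step 1: the butterfly pass, `2^κ + 2^κ` weighted additions
    have h1 := hv.extend_wadd (κ := Fin (2 ^ κ) ⊕ Fin (2 ^ κ))
      (Sum.elim (fun _ => (1 : k)) (fun l => ζ ^ (l : ℕ)))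
      (Sum.elim (fun _ => (1 : k)) (fun l => -(ζ ^ (l : ℕ))))
      (Sum.elim (fun l => e (lo l)) (fun l => e (lo l)))
      (Sum.elim (fun l => e (hi l)) (fun l => e (hi l)))
    rw [Fintype.card_sum, Fintype.card_fin] at h1
    have hb_mem : ∀ l : Fin (2 ^ κ),
        Sum.elim v (fun j : Fin (2 ^ κ) ⊕ Fin (2 ^ κ) =>
          Sum.elim (fun _ => (1 : k)) (fun l : Fin (2 ^ κ) => ζ ^ (l : ℕ)) j •
              v (Sum.elim (fun l => e (lo l)) (fun l => e (lo l)) j) +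
            Sum.elim (fun _ => (1 : k)) (fun l : Fin (2 ^ κ) => -(ζ ^ (l : ℕ))) j •
              v (Sum.elim (fun l => e (hi l)) (fun l => e (hi l)) j))
          (Sum.inr (Sum.inl l)) = b l := by
      intro l
      simp only [Sum.elim_inr, Sum.elim_inl, one_smul, he, hb]
      rfl
    have hc_mem : ∀ l : Fin (2 ^ κ),
        Sum.elim v (fun j : Fin (2 ^ κ) ⊕ Fin (2 ^ κ) =>
          Sum.elim (fun _ => (1 : k)) (fun l : Fin (2 ^ κ) => ζ ^ (l : ℕ)) j •
              v (Sum.elim (fun l => e (lo l)) (fun l => e (lo l)) j) +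
            Sum.elim (fun _ => (1 : k)) (fun l : Fin (2 ^ κ) => -(ζ ^ (l : ℕ))) j •
              v (Sum.elim (fun l => e (hi l)) (fun l => e (hi l)) j))
          (Sum.inr (Sum.inr l)) = c l := by
      intro l
      simp only [Sum.elim_inr, he, hc, smul_eq_C_mul, C_neg, C_pow]
      change C ζ ^ (l : ℕ) * a (l : ℕ) + -(C ζ ^ (l : ℕ)) * a (2 ^ κ + (l : ℕ)) = _
      ring
    -- step 2: transform `b` with `ζ²`
    have h2 := jointlyComputed_dft κ _ _ (ζ * ζ) b (fun l => Sum.inr (Sum.inl l)) h1 hb_mem hζ2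
    -- step 3: transform `c` with `ζ²`
    have h3 := jointlyComputed_dft κ _ _ (ζ * ζ) c (fun l => Sum.inl (Sum.inr (Sum.inr l))) h2
      (fun l => by simpa using hc_mem l) hζ2
    have hcost : s + (2 ^ κ + 2 ^ κ) + κ * 2 ^ κ + κ * 2 ^ κ = s + (κ + 1) * 2 ^ (κ + 1) := by
      rw [hlen]; ring
    rw [hcost] at h3
    -- step 4: read off the outputs (even ones from `b`, odd ones from `c`)
    refine h3.of_mem _ ?_
    rintro (i | j)
    · exact Or.inl ⟨Sum.inl (Sum.inl (Sum.inl i)), rfl⟩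
    · refine Or.inl ?_
      have hj := j.isLt
      rcases Nat.even_or_odd (j : ℕ) with ⟨i, hi2⟩ | ⟨i, hi2⟩
      · have hi' : i < 2 ^ κ := by omega
        refine ⟨Sum.inl (Sum.inr ⟨i, hi'⟩), ?_⟩
        simp only [Sum.elim_inr, Sum.elim_inl]
        rw [hi2, hlen, show i + i = 2 * i by ring, dft_add_even _ hω, C_mul]
      · have hi' : i < 2 ^ κ := by omega
        refine ⟨Sum.inr ⟨i, hi'⟩, ?_⟩
        simp only [Sum.elim_inr]
        rw [hi2, hlen, dft_add_odd _ hω, C_mul]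

/-! ### Cyclic and linear convolution of circuit nodes -/

/-- **Fast cyclic convolution as a circuit** (GG Algorithm 8.16 / Thm 8.18, cost part): the cyclic
convolution of length `t = 2^κ` (`κ ≥ 1`) of two node sequences costs `(3κ + 2) · 2^κ` gates —
three FFTs (`jointlyComputed_dft`), `t` pointwise products, and `t` scalings by `t⁻¹` of the
reversed third transform (`dft_cconv`, `dft_dft`; `ζ^{2^{κ-1}} = −1`, `2^κ · tinv = 1`).
[cite: GathenGerhard2013, §8.2 Thm 8.18] -/
theorem jointlyComputed_cconv {ι : Type ww} {v : ι → MvPolynomial τ k} {s : ℕ}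
    (hv : JointlyComputed v s) {κ : ℕ} (hκ : κ ≠ 0) {ζ tinv : k}
    (hζ : ζ ^ 2 ^ (κ - 1) = -1) (ht : (2 ^ κ : k) * tinv = 1)
    (a b : ℕ → MvPolynomial τ k) (ea eb : Fin (2 ^ κ) → ι)
    (hea : ∀ i, v (ea i) = a i) (heb : ∀ i, v (eb i) = b i) :
    JointlyComputed (Sum.elim v (fun m : Fin (2 ^ κ) => cconv (2 ^ κ) a b m))
      (s + (3 * κ + 2) * 2 ^ κ) := by
  have htpos : 0 < 2 ^ κ := Nat.two_pow_pos κ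
  -- `ω = C ζ` is a principal `2^κ`-th root of unity
  have hωhalf : (C ζ : MvPolynomial τ k) ^ 2 ^ (κ - 1) = -1 := by rw [← C_pow, hζ, C_neg, C_1]
  have hprin : IsPrincipalRoot (2 ^ κ) (C ζ : MvPolynomial τ k) := by
    have := IsPrincipalRoot.of_pow_eq_neg_one (κ - 1) hωhalf
    rwa [Nat.sub_add_cancel (Nat.one_le_iff_ne_zero.2 hκ)] at this
  have hζ' : κ ≠ 0 → ζ ^ 2 ^ (κ - 1) = -1 := fun _ => hζ
  -- three transforms and the pointwise products
  have h1 := jointlyComputed_dft κ v s ζ a ea hv hea hζ'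
  have h2 := jointlyComputed_dft κ _ _ ζ b (fun i => Sum.inl (eb i)) h1
    (fun i => by simp [heb]) hζ'
  have h3 := h2.extend_mul (κ := Fin (2 ^ κ)) (fun j => Sum.inl (Sum.inr j)) (fun j => Sum.inr j)
  rw [Fintype.card_fin] at h3
  set p : ℕ → MvPolynomial τ k := fun j => dft (2 ^ κ) (C ζ) a j * dft (2 ^ κ) (C ζ) b j with hp
  have hp' : ∀ j, p j = dft (2 ^ κ) (C ζ) (cconv (2 ^ κ) a b) j := fun j =>
    (dft_cconv hprin.pow_eq_one a b j).symm
  have h4 := jointlyComputed_dft κ _ _ ζ p (fun j => Sum.inr j) h3 (fun j => by simp [hp]) hζ'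
  -- the reversal-and-scaling pass
  let rev : Fin (2 ^ κ) → Fin (2 ^ κ) := fun m => ⟨(2 ^ κ - m) % 2 ^ κ, Nat.mod_lt _ htpos⟩
  have h5 := h4.extend_smul (κ := Fin (2 ^ κ)) (fun _ => tinv) (fun m => Sum.inr (rev m))
  rw [Fintype.card_fin] at h5
  have hcost : s + κ * 2 ^ κ + κ * 2 ^ κ + 2 ^ κ + κ * 2 ^ κ + 2 ^ κ =
      s + (3 * κ + 2) * 2 ^ κ := by ring
  rw [hcost] at h5
  refine h5.of_mem _ ?_
  rintro (i | m)
  · exact Or.inl ⟨Sum.inl (Sum.inl (Sum.inl (Sum.inl (Sum.inl i)))), rfl⟩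
  · refine Or.inl ⟨Sum.inr m, ?_⟩
    have hm := m.isLt
    have hrev : (2 ^ κ - (2 ^ κ - (m : ℕ)) % 2 ^ κ) % 2 ^ κ = m := by
      rcases Nat.eq_zero_or_pos (m : ℕ) with h0 | hpos
      · rw [h0, Nat.sub_zero, Nat.mod_self, Nat.sub_zero, Nat.mod_self]
      · rw [Nat.mod_eq_of_lt (show 2 ^ κ - (m : ℕ) < 2 ^ κ by omega),
          Nat.sub_sub_self hm.le, Nat.mod_eq_of_lt hm]
    simp only [Sum.elim_inr]
    rw [dft_congr (fun j _ => hp' j), dft_dft hprin _ (Nat.mod_lt _ htpos), hrev,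
      smul_eq_C_mul, ← mul_assoc]
    have hsc : (C tinv : MvPolynomial τ k) * ((2 ^ κ : ℕ) : MvPolynomial τ k) = 1 := by
      rw [← map_natCast (C : k →+* MvPolynomial τ k), ← C_mul, Nat.cast_pow, Nat.cast_ofNat,
        mul_comm, ht, C_1]
    rw [hsc, one_mul]

/-- The **linear convolution** (Cauchy product) of two sequences: `(a ∗ b)_m = Σ_{i+j=m} a_i b_j` —
the coefficient of a product of polynomials or power series (`Polynomial.coeff_mul`,
`PowerSeries.coeff_mul`). [cite: GathenGerhard2013, §8.2 (polynomial multiplication via convolution)] -/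
def lconv {S : Type*} [CommSemiring S] (a b : ℕ → S) (m : ℕ) : S :=
  ∑ ij ∈ antidiagonal m, a ij.1 * b ij.2

/-- **No wrap-around**: if `a` vanishes from index `la` on, `b` from `lb` on, and
`la + lb ≤ t + 1`, then the cyclic convolution of length `t` agrees with the linear one below `t`
(GG §8.2: multiplying polynomials of small degree modulo `x^t − 1` is exact).
[cite: GathenGerhard2013, §8.2 Lemma 8.11] -/
theorem cconv_eq_lconv {S : Type*} [CommRing S] {t la lb : ℕ} (a b : ℕ → S)
    (ha : ∀ i, la ≤ i → a i = 0) (hb : ∀ j, lb ≤ j → b j = 0) (hab : la + lb ≤ t + 1)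
    {m : ℕ} (hm : m < t) : cconv t a b m = lconv a b m := by
  unfold cconv lconv
  rw [Nat.sum_antidiagonal_eq_sum_range_succ_mk, range_eq_Ico,
    ← sum_Ico_consecutive _ (Nat.zero_le (m + 1)) (by omega : m + 1 ≤ t), ← range_eq_Ico]
  have htail : ∑ i ∈ Ico (m + 1) t, a i * b ((m + (t - i)) % t) = 0 := by
    refine sum_eq_zero fun i hi => ?_
    rw [mem_Ico] at hi
    by_cases hia : la ≤ i
    · rw [ha i hia, zero_mul]
    · rw [hb _ ?_, mul_zero]
      rw [Nat.mod_eq_of_lt (by omega)]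
      omega
  rw [htail, add_zero]
  refine sum_congr rfl fun i hi => ?_
  rw [mem_range] at hi
  congr 2
  rw [show m + (t - i) = (m - i) + t by omega, Nat.add_mod_right, Nat.mod_eq_of_lt (by omega)]

/-- **Fast polynomial multiplication as a circuit** (GG Thm 8.18 / Cor. 8.19, cost part, with the
scalings free): if node sequences `a` (zero from `la` on) and `b` (zero from `lb` on) with
`la + lb ≤ 2^κ + 1` are read off a jointly computed family within `s` gates, then so are all the
coefficients `(a ∗ b)_m`, `m < 2^κ`, of their Cauchy product within `s + (3κ + 2) · 2^κ` gates
(`κ ≥ 1`, `ζ^{2^{κ-1}} = −1`, `2^κ · tinv = 1`). [cite: GathenGerhard2013, §8.2 Thm 8.18] -/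
theorem jointlyComputed_lconv {ι : Type ww} {v : ι → MvPolynomial τ k} {s : ℕ}
    (hv : JointlyComputed v s) {κ : ℕ} (hκ : κ ≠ 0) {ζ tinv : k}
    (hζ : ζ ^ 2 ^ (κ - 1) = -1) (ht : (2 ^ κ : k) * tinv = 1)
    (a b : ℕ → MvPolynomial τ k) {la lb : ℕ}
    (ha : ∀ i, la ≤ i → a i = 0) (hb : ∀ j, lb ≤ j → b j = 0) (hab : la + lb ≤ 2 ^ κ + 1)
    (ea : Fin la → ι) (eb : Fin lb → ι)
    (hea : ∀ i, v (ea i) = a i) (heb : ∀ j, v (eb j) = b j) :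
    JointlyComputed (Sum.elim v (fun m : Fin (2 ^ κ) => lconv a b m))
      (s + (3 * κ + 2) * 2 ^ κ) := by
  -- pad the inputs with the constant `0`
  let w : ι ⊕ (Fin (2 ^ κ) ⊕ Fin (2 ^ κ)) → MvPolynomial τ k :=
    Sum.elim v (Sum.elim (fun i => a i) (fun j => b j))
  have hw : JointlyComputed w s := by
    refine hv.of_mem _ ?_
    rintro (i | (i | j))
    · exact Or.inl ⟨i, rfl⟩
    · by_cases h : (i : ℕ) < la
      · exact Or.inl ⟨ea ⟨i, h⟩, (hea ⟨i, h⟩).symm⟩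
      · exact Or.inr (Or.inr ⟨0, by simp [w, ha i (not_lt.1 h)]⟩)
    · by_cases h : (j : ℕ) < lb
      · exact Or.inl ⟨eb ⟨j, h⟩, (heb ⟨j, h⟩).symm⟩
      · exact Or.inr (Or.inr ⟨0, by simp [w, hb j (not_lt.1 h)]⟩)
  have h1 := jointlyComputed_cconv hw hκ hζ ht a b (fun i => Sum.inr (Sum.inl i))
    (fun j => Sum.inr (Sum.inr j)) (fun i => rfl) (fun j => rfl)
  refine h1.of_mem _ ?_
  rintro (i | m)
  · exact Or.inl ⟨Sum.inl (Sum.inl i), rfl⟩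
  · refine Or.inl ⟨Sum.inr m, ?_⟩
    simp only [Sum.elim_inr]
    exact (cconv_eq_lconv a b ha hb hab m.isLt).symm

end FFTCost

end Literature.Computability.AlgebraicComplexity

end
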